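import Mathlib

/-!
# Stub `reduction_local` (plan T3a) of line `Sketch` for crux `WeilComb.CombShapePositivity`
(item stmt-RiemannHypothesis-11229, route route-RiemannHypothesis-WeilComb, stub-plan
`Cruxes/CombShapePositivity/STUB-PLAN-stub_fejer.md`, tier T3a = first half of ★T3 "two-prime collapse")

The S-LOCAL, EVENTUAL-in-`n` PRODUCT-VECTOR (Bohr–Fejér) REDUCTION for an ARBITRARY kernel
`w : ℝ → ℂ`. Fix a finite set of primes `S` and `n₀`. If `Re Σ_{d,d' ∣ N} χ_θ(d) conj χ_θ(d')
w(log d − log d') ≥ 0` for every box `N = ∏_{p ∈ S} p ^ n`, `n ≥ n₀`, and every Bohr character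
`χ_θ(d) = exp(i Σ_{p∈S} θ_p v_p(d))`, then `Re Σ_{m,m' ∈ T} c_m conj(c_{m'}) w(log m − log m') ≥ 0`
for every finite set `T` of `S`-smooth positive integers and every `c`. This is the S-local variant of
`WeilCombBohrFejer.stub_reduction` (`Theorems/WeilCombCombShapePositivityStubReduction.lean`, where
`S :=` primes `≤ M`, nodes `Icc 1 M`); same grid-averaging proof, helper lemmas copied (private there).
Put `K = n₀ + max T` (every `m ∈ T` divides `∏_{p∈S} p^K`), `N = ∏_{p∈S} p^(n+K)`, a modulus
`L > K N`, grid `θ_k = 2πk/L`, `k ∈ (ℤ/L)^S`, `A(θ) = Σ_{m∈T} c_m conj χ_θ(m)`, `B(θ)` the box form: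
`Re (|A(θ_k)|² B(θ_k)) ≥ 0`, the grid average of `|A|² B` kills every character `χ_θ(m' d) conj χ_θ(m d')`
with `m' d ≠ m d'` (orthogonality, valuations `< L`), and on the survivors `w(log d − log d') =
w(log m − log m')`. Hence `0 ≤ Re Σ c_m conj c_{m'} w(log m − log m') C_n(m,m')`,
`C_n(m,m') = #{(d,d') ∣ N : m' d = m d'}`, `(n+1)^{|S|} ≤ C_n ≤ (n+K+1)^{|S|} = #div N`; let `n → ∞`.
-/

noncomputable section

-- the sub-problem path RiemannHypothesis/RiemannHypothesis duplicates a namespace (D-0017)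
set_option linter.dupNamespace false

open scoped BigOperators ComplexConjugate Real
open Complex Finset

namespace Summit.RiemannHypothesis.RiemannHypothesis.Theorems.WeilCombBohrFejer

-- private helpers copied from …StubReduction.lean (private there); `avg_identity`: `Icc 1 M` ↦ `T`
/-- One-dimensional orthogonality of the `L`-th roots of unity: for an integer frequency `u` with
`|u| < L`, `Σ_{j<L} exp(2πi j u / L)` is `L` if `u = 0` and `0` otherwise. [folklore] -/
private theorem orth_one (L : ℕ) (u : ℤ) (hu : |u| < L) :
    ∑ j ∈ Finset.range L, Complex.exp (I * ((2 * π * (j : ℝ) / L * (u : ℝ) : ℝ) : ℂ)) =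
      if u = 0 then (L : ℂ) else 0 := by
  split_ifs with h
  · simp [h]
  · have hL0 : (L : ℂ) ≠ 0 := by
      have := abs_nonneg u
      exact_mod_cast (show 0 < L by omega).ne'
    have hI : (2 * π * I : ℂ) ≠ 0 := by simp [Real.pi_ne_zero]
    have hr : ∀ j ∈ Finset.range L,
        Complex.exp (I * ((2 * π * (j : ℝ) / L * (u : ℝ) : ℝ) : ℂ)) =
          Complex.exp (2 * π * I * u / L) ^ j := by
      intro j _
      rw [← Complex.exp_nat_mul]
      congr 1
      push_cast
      ring
    have hne : Complex.exp (2 * π * I * u / L) ≠ 1 := by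
      intro h1
      obtain ⟨n, hn⟩ := Complex.exp_eq_one_iff.mp h1
      rw [div_eq_iff hL0] at hn
      have h3 : (2 * π * I : ℂ) * u = (2 * π * I) * (n * L) := by linear_combination hn
      have hun : (u : ℂ) = n * L := mul_left_cancel₀ hI h3
      have hun' : u = n * L := by exact_mod_cast hun
      exact h (Int.eq_zero_of_abs_lt_dvd ⟨n, by rw [hun']; ring⟩ hu)
    rw [Finset.sum_congr rfl hr, geom_sum_eq hne, ← Complex.exp_nat_mul,
      show (L : ℂ) * (2 * π * I * u / L) = u * (2 * π * I) by
        rw [mul_comm, div_mul_cancel₀ _ hL0]; ring,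
      Complex.exp_int_mul_two_pi_mul_I]
    simp

/-- Orthogonality on the discrete torus `(ℤ/L)^S` (grid `θ_k(p) = 2π k_p / L`): for integer
frequencies `u_p` with `|u_p| < L` (`p ∈ S`), `Σ_k exp(i Σ_{p∈S} θ_k(p) u_p)` is `L^{|S|}` if
`u_p = 0` for all `p ∈ S`, and `0` otherwise. [folklore] -/
private theorem orth_grid (S : Finset ℕ) (L : ℕ) (θ : (↥S → ℕ) → ℕ → ℝ)
    (hθ : ∀ k (p : ↥S), θ k p = 2 * π * (k p : ℝ) / L) (u : ℕ → ℤ)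
    (hu : ∀ p ∈ S, |u p| < L) :
    ∑ k ∈ Fintype.piFinset (fun _ : ↥S => Finset.range L),
      Complex.exp (I * ((∑ p ∈ S, θ k p * (u p : ℝ) : ℝ) : ℂ)) =
      if ∀ p ∈ S, u p = 0 then (L : ℂ) ^ S.card else 0 := by
  have hterm : ∀ k : ↥S → ℕ, Complex.exp (I * ((∑ p ∈ S, θ k p * (u p : ℝ) : ℝ) : ℂ)) =
      ∏ p : ↥S, Complex.exp (I * ((2 * π * (k p : ℝ) / L * (u p : ℝ) : ℝ) : ℂ)) := by
    intro k
    rw [← Finset.sum_coe_sort S, Complex.ofReal_sum, Finset.mul_sum, Complex.exp_sum]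
    refine Finset.prod_congr rfl fun p _ => ?_
    rw [hθ k p]
  simp_rw [hterm]
  rw [Finset.sum_prod_piFinset (Finset.range L)
    (fun (p : ↥S) (j : ℕ) => Complex.exp (I * ((2 * π * (j : ℝ) / L * (u p : ℝ) : ℝ) : ℂ))),
    Finset.prod_congr rfl fun (p : ↥S) _ => orth_one L (u p) (hu p p.2)]
  split_ifs with h
  · rw [Finset.prod_congr rfl fun (p : ↥S) _ => if_pos (h p p.2), Finset.prod_const,
      Finset.card_univ, Fintype.card_coe]
  · push Not at h
    obtain ⟨p, hp, hne⟩ := h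
    exact Finset.prod_eq_zero (Finset.mem_univ (⟨p, hp⟩ : ↥S)) (if_neg hne)

/-- Pair orthogonality of the Bohr characters `χ_θ(x) = exp(i Σ_{p∈S} θ_p v_p(x))` on the grid
`θ_k = 2πk/L`: for `X, Y ≠ 0` supported on `S` with `X, Y < L`,
`Σ_k χ_{θ_k}(X) conj χ_{θ_k}(Y)` is `L^{|S|}` if `X = Y` and `0` otherwise. [folklore] -/
private theorem orth_pair (S : Finset ℕ) (L : ℕ) (θ : (↥S → ℕ) → ℕ → ℝ)
    (hθ : ∀ k (p : ↥S), θ k p = 2 * π * (k p : ℝ) / L) {X Y : ℕ} (hX : X ≠ 0) (hY : Y ≠ 0)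
    (hXS : X.primeFactors ⊆ S) (hYS : Y.primeFactors ⊆ S) (hXL : X < L) (hYL : Y < L) :
    ∑ k ∈ Fintype.piFinset (fun _ : ↥S => Finset.range L),
      Complex.exp (I * ((∑ p ∈ S, θ k p * (X.factorization p : ℝ) : ℝ) : ℂ)) *
        conj (Complex.exp (I * ((∑ p ∈ S, θ k p * (Y.factorization p : ℝ) : ℝ) : ℂ))) =
      if X = Y then (L : ℂ) ^ S.card else 0 := by
  have hu : ∀ p ∈ S, |((X.factorization p : ℤ) - (Y.factorization p : ℤ))| < L := by
    intro p _
    have h1 := Nat.factorization_lt p hX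
    have h2 := Nat.factorization_lt p hY
    rw [abs_lt]
    constructor <;> omega
  have hterm : ∀ k : ↥S → ℕ,
      Complex.exp (I * ((∑ p ∈ S, θ k p * (X.factorization p : ℝ) : ℝ) : ℂ)) *
        conj (Complex.exp (I * ((∑ p ∈ S, θ k p * (Y.factorization p : ℝ) : ℝ) : ℂ))) =
      Complex.exp (I * ((∑ p ∈ S, θ k p *
        (((X.factorization p : ℤ) - (Y.factorization p : ℤ) : ℤ) : ℝ) : ℝ) : ℂ)) := by
    intro k
    rw [← Complex.exp_conj, ← Complex.exp_add, map_mul, Complex.conj_I, Complex.conj_ofReal]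
    congr 1
    push_cast
    simp only [mul_sub, Finset.sum_sub_distrib]
    ring
  simp_rw [hterm]
  rw [orth_grid S L θ hθ (fun p => (X.factorization p : ℤ) - (Y.factorization p : ℤ)) hu]
  by_cases hXY : X = Y
  · rw [if_pos hXY, if_pos]
    intro p _
    simp [hXY]
  · rw [if_neg hXY, if_neg]
    intro hall
    refine hXY (Nat.eq_of_factorization_eq hX hY fun p => ?_)
    by_cases hp : p ∈ S
    · have := hall p hp
      beta_reduce at this
      omega
    · have hx : X.factorization p = 0 :=
        Finsupp.notMem_support_iff.mp fun h' => hp (hXS (by simpa using h'))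
      have hy : Y.factorization p = 0 :=
        Finsupp.notMem_support_iff.mp fun h' => hp (hYS (by simpa using h'))
      rw [hx, hy]

/-- The Bohr character is multiplicative: `χ_θ(x y) = χ_θ(x) χ_θ(y)` for `x, y ≠ 0`. [folklore] -/
private theorem chi_mul (S : Finset ℕ) (θ : ℕ → ℝ) {x y : ℕ} (hx : x ≠ 0) (hy : y ≠ 0) :
    Complex.exp (I * ((∑ p ∈ S, θ p * ((x * y).factorization p : ℝ) : ℝ) : ℂ)) =
      Complex.exp (I * ((∑ p ∈ S, θ p * (x.factorization p : ℝ) : ℝ) : ℂ)) *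
        Complex.exp (I * ((∑ p ∈ S, θ p * (y.factorization p : ℝ) : ℝ) : ℂ)) := by
  rw [← Complex.exp_add, Nat.factorization_mul hx hy]
  congr 1
  simp only [Finsupp.coe_add, Pi.add_apply, Nat.cast_add, mul_add, Finset.sum_add_distrib,
    Complex.ofReal_add]

/-- `Re (z n) = Re z · n` for a natural number `n`. [folklore] -/
private theorem re_mul_natCast (z : ℂ) (n : ℕ) : (z * n).re = z.re * n := by
  rw [← Complex.ofReal_natCast, Complex.re_mul_ofReal]

/-- If `Σ_k f k = L^s · z` with every `Re (f k) ≥ 0` and `L > 0`, then `Re z ≥ 0`. [folklore] -/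
private theorem re_nonneg_of_sum_eq {ι : Type*} {G : Finset ι} {f : ι → ℂ} {L s : ℕ} {z : ℂ}
    (hL : 0 < L) (h : ∑ k ∈ G, f k = (L : ℂ) ^ s * z) (hf : ∀ k ∈ G, 0 ≤ (f k).re) :
    0 ≤ z.re := by
  have h1 : 0 ≤ (∑ k ∈ G, f k).re := by
    rw [Complex.re_sum]
    exact Finset.sum_nonneg hf
  rw [h, ← Complex.ofReal_natCast, ← Complex.ofReal_pow, Complex.re_ofReal_mul] at h1
  exact (mul_nonneg_iff_of_pos_left (by positivity)).mp h1

/-- Upper count: the pairs `(d, d')` of divisors of `N` with `m' d = m d'` (`m ≠ 0`) inject into the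
divisors of `N` by `(d, d') ↦ d`. [folklore] -/
private theorem count_upper (N m m' : ℕ) (hm : m ≠ 0) :
    ((N.divisors ×ˢ N.divisors).filter (fun x : ℕ × ℕ => m' * x.1 = m * x.2)).card ≤
      N.divisors.card := by
  refine Finset.card_le_card_of_injOn Prod.fst (fun x hx => ?_) fun x hx y hy hxy => ?_
  · exact (Finset.mem_product.mp (Finset.mem_filter.mp hx).1).1
  · have hx' := (Finset.mem_filter.mp hx).2
    have hy' := (Finset.mem_filter.mp hy).2
    refine Prod.ext hxy (Nat.eq_of_mul_eq_mul_left (Nat.pos_of_ne_zero hm) ?_)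
    rw [← hx', ← hy', hxy]

/-- Lower count: if `N' m ∣ N` and `N' m' ∣ N` (`N, m ≠ 0`), the divisors `e` of `N'` inject into the
pairs `(d, d')` of divisors of `N` with `m' d = m d'` by `e ↦ (e m, e m')`. [folklore] -/
private theorem count_lower (N N' m m' : ℕ) (hN : N ≠ 0) (hm : m ≠ 0) (h1 : N' * m ∣ N)
    (h2 : N' * m' ∣ N) :
    N'.divisors.card ≤
      ((N.divisors ×ˢ N.divisors).filter (fun x : ℕ × ℕ => m' * x.1 = m * x.2)).card := by
  refine Finset.card_le_card_of_injOn (fun e => (e * m, e * m')) (fun e he => ?_)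
    fun e _ e' _ h => ?_
  · have he' : e ∣ N' := Nat.dvd_of_mem_divisors he
    refine Finset.mem_filter.mpr ⟨Finset.mem_product.mpr ⟨?_, ?_⟩, by ring⟩
    · exact Nat.mem_divisors.mpr ⟨(mul_dvd_mul_right he' m).trans h1, hN⟩
    · exact Nat.mem_divisors.mpr ⟨(mul_dvd_mul_right he' m').trans h2, hN⟩
  · exact Nat.eq_of_mul_eq_mul_right (Nat.pos_of_ne_zero hm) (Prod.mk.inj h).1

/-- `#div (∏_{p∈S} p^k) = (k+1)^{|S|}` for a finite set of primes `S`. [folklore] -/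
private theorem card_divisors_prod_pow (S : Finset ℕ) (hS : ∀ p ∈ S, p.Prime) (k : ℕ) :
    (∏ p ∈ S, p ^ k).divisors.card = (k + 1) ^ S.card := by
  rw [← ArithmeticFunction.sigma_zero_apply,
    ArithmeticFunction.isMultiplicative_sigma.map_prod (fun p => p ^ k)]
  · rw [Finset.prod_congr rfl fun p hp => ArithmeticFunction.sigma_zero_apply_prime_pow (hS p hp),
      Finset.prod_const]
  · intro p hp q hq hpq
    exact Nat.coprime_pow_primes k k (hS p hp) (hS q hq) hpq

/-- The prime factors of `∏_{p∈S} p^k` lie in `S` (for a set of primes `S`). [folklore] -/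
private theorem primeFactors_prod_pow_subset (S : Finset ℕ) (hS : ∀ p ∈ S, p.Prime) (k : ℕ) :
    (∏ p ∈ S, p ^ k).primeFactors ⊆ S := by
  intro q hq
  obtain ⟨hqp, hqd, -⟩ := Nat.mem_primeFactors.mp hq
  obtain ⟨p, hp, hdvd⟩ := (hqp.prime.dvd_finsetProd_iff _).mp hqd
  rwa [(Nat.prime_dvd_prime_iff_eq hqp (hS p hp)).mp (hqp.dvd_of_dvd_pow hdvd)]

/-- Every `0 < m ≤ M` whose prime factors lie in `S` divides `∏_{p∈S} p^M`. [folklore] -/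
private theorem dvd_prod_pow (S : Finset ℕ) (M : ℕ) {m : ℕ} (hm : m ≠ 0) (hmM : m ≤ M)
    (hmS : m.primeFactors ⊆ S) : m ∣ ∏ p ∈ S, p ^ M := by
  rw [Nat.prod_primeFactors_pow_factorization hm]
  exact (Finset.prod_dvd_prod_of_dvd _ _ fun p _ =>
    pow_dvd_pow p ((Nat.factorization_lt p hm).le.trans hmM)).trans
    (Finset.prod_dvd_prod_of_subset _ _ _ hmS)

/-- Fejér weights: if `(n+1)^s ≤ C n ≤ (n+M+1)^s` then `C n / (n+M+1)^s → 1`. [folklore] -/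
private theorem ratio_tendsto_one (M s : ℕ) (C : ℕ → ℕ) (hlo : ∀ n, (n + 1) ^ s ≤ C n)
    (hhi : ∀ n, C n ≤ (n + M + 1) ^ s) :
    Filter.Tendsto (fun n : ℕ => (C n : ℝ) / ((n : ℝ) + M + 1) ^ s) Filter.atTop (nhds 1) := by
  have h1 : Filter.Tendsto (fun n : ℕ => (((n : ℝ) + 1) / ((n : ℝ) + M + 1)) ^ s)
      Filter.atTop (nhds 1) := by
    have h := ((tendsto_natCast_div_add_atTop (M : ℝ)).comp (Filter.tendsto_add_atTop_nat 1)).pow s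
    rw [one_pow] at h
    refine h.congr fun n => ?_
    simp only [Function.comp_apply, Nat.cast_add, Nat.cast_one]
    ring
  refine tendsto_of_tendsto_of_tendsto_of_le_of_le h1 tendsto_const_nhds (fun n => ?_) fun n => ?_
  · have : ((n : ℝ) + 1) ^ s ≤ (C n : ℝ) := by exact_mod_cast hlo n
    show (((n : ℝ) + 1) / ((n : ℝ) + M + 1)) ^ s ≤ (C n : ℝ) / ((n : ℝ) + M + 1) ^ s
    rw [div_pow]
    gcongr
  · have : (C n : ℝ) ≤ ((n : ℝ) + M + 1) ^ s := by exact_mod_cast hhi n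
    show (C n : ℝ) / ((n : ℝ) + M + 1) ^ s ≤ 1
    rwa [div_le_one (by positivity)]

/-- THE AVERAGING IDENTITY (pure algebra) on an arbitrary finite set `T` of nonzero nodes. For
"characters" `χ k` (multiplicative on nonzero naturals) whose pair sums over the grid `G` are
`c · [m' d = m d']`, the grid sum of `|A_k|² B_k`, `A_k = Σ_{m∈T} a_m conj χ_k(m)`,
`B_k = Σ_{d,d'} χ_k(d) conj χ_k(d') w(log d − log d')`, equals
`c · Σ_{m,m'∈T} a_m conj a_{m'} w(log m − log m') · #{(d,d') : m' d = m d'}`. [folklore] -/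
private theorem avg_identity {ι : Type*} (G : Finset ι) (χ : ι → ℕ → ℂ) (c : ℂ) (T : Finset ℕ)
    (hI : ∀ m ∈ T, m ≠ 0) (N : ℕ)
    (hmul : ∀ k x y, x ≠ 0 → y ≠ 0 → χ k (x * y) = χ k x * χ k y)
    (horth : ∀ m ∈ T, ∀ m' ∈ T, ∀ d ∈ N.divisors, ∀ d' ∈ N.divisors,
      ∑ k ∈ G, χ k (m' * d) * conj (χ k (m * d')) = if m' * d = m * d' then c else 0)
    (w : ℝ → ℂ) (a : ℕ → ℂ) :
    ∑ k ∈ G, (∑ m ∈ T, a m * conj (χ k m)) * conj (∑ m ∈ T, a m * conj (χ k m)) *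
        (∑ d ∈ N.divisors, ∑ d' ∈ N.divisors,
          χ k d * conj (χ k d') * w (Real.log (d : ℝ) - Real.log (d' : ℝ))) =
      c * ∑ m ∈ T, ∑ m' ∈ T,
        a m * conj (a m') * w (Real.log (m : ℝ) - Real.log (m' : ℝ)) *
          (((N.divisors ×ˢ N.divisors).filter
            (fun x : ℕ × ℕ => m' * x.1 = m * x.2)).card : ℂ) := by
  have hD : ∀ d ∈ N.divisors, d ≠ 0 := fun d hd => (Nat.pos_of_mem_divisors hd).ne'
  -- Step 1: expand each `k`-term into a fourfold sum of `coefficient × character bracket`.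
  have step1 : ∀ k ∈ G, (∑ m ∈ T, a m * conj (χ k m)) * conj (∑ m ∈ T, a m * conj (χ k m)) *
      (∑ d ∈ N.divisors, ∑ d' ∈ N.divisors,
        χ k d * conj (χ k d') * w (Real.log (d : ℝ) - Real.log (d' : ℝ))) =
      ∑ m ∈ T, ∑ m' ∈ T, ∑ d ∈ N.divisors, ∑ d' ∈ N.divisors,
        a m * conj (a m') * w (Real.log (d : ℝ) - Real.log (d' : ℝ)) *
          (χ k (m' * d) * conj (χ k (m * d'))) := by
    intro k _
    rw [map_sum, Finset.sum_mul_sum]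
    simp only [Finset.sum_mul]
    simp only [Finset.mul_sum]
    refine Finset.sum_congr rfl fun m hm => Finset.sum_congr rfl fun m' hm' =>
      Finset.sum_congr rfl fun d hd => Finset.sum_congr rfl fun d' hd' => ?_
    rw [hmul k m' d (hI m' hm') (hD d hd), hmul k m d' (hI m hm) (hD d' hd')]
    simp only [map_mul, Complex.conj_conj]
    ring
  rw [Finset.sum_congr rfl step1, Finset.sum_comm, Finset.mul_sum]
  refine Finset.sum_congr rfl fun m hm => ?_
  rw [Finset.sum_comm, Finset.mul_sum]
  refine Finset.sum_congr rfl fun m' hm' => ?_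
  -- Step 2: the `k`-sum of the character bracket is `c · [m' d = m d']`.
  have step2 : ∑ k ∈ G, ∑ d ∈ N.divisors, ∑ d' ∈ N.divisors,
      a m * conj (a m') * w (Real.log (d : ℝ) - Real.log (d' : ℝ)) *
        (χ k (m' * d) * conj (χ k (m * d'))) =
      ∑ d ∈ N.divisors, ∑ d' ∈ N.divisors, if m' * d = m * d' then
        a m * conj (a m') * w (Real.log (d : ℝ) - Real.log (d' : ℝ)) * c else 0 := by
    rw [Finset.sum_comm]
    refine Finset.sum_congr rfl fun d hd => ?_
    rw [Finset.sum_comm]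
    refine Finset.sum_congr rfl fun d' hd' => ?_
    rw [← Finset.mul_sum, horth m hm m' hm' d hd d' hd', mul_ite, mul_zero]
  -- Step 3: on the solution set `m' d = m d'` the kernel value is `w (log m - log m')`.
  have step3 : ∀ x ∈ (N.divisors ×ˢ N.divisors).filter (fun x : ℕ × ℕ => m' * x.1 = m * x.2),
      a m * conj (a m') * w (Real.log (x.1 : ℝ) - Real.log (x.2 : ℝ)) * c =
        a m * conj (a m') * w (Real.log (m : ℝ) - Real.log (m' : ℝ)) * c := by
    intro x hx
    obtain ⟨hx, hP⟩ := Finset.mem_filter.mp hx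
    obtain ⟨hx1, hx2⟩ := Finset.mem_product.mp hx
    have hl : Real.log (m' : ℝ) + Real.log (x.1 : ℝ) = Real.log (m : ℝ) + Real.log (x.2 : ℝ) := by
      rw [← Real.log_mul (by exact_mod_cast hI m' hm') (by exact_mod_cast hD _ hx1),
        ← Real.log_mul (by exact_mod_cast hI m hm) (by exact_mod_cast hD _ hx2)]
      exact_mod_cast congrArg (fun t : ℕ => Real.log (t : ℝ)) hP
    rw [show Real.log (x.1 : ℝ) - Real.log (x.2 : ℝ) = Real.log (m : ℝ) - Real.log (m' : ℝ) by
      linarith]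
  rw [step2, ← Finset.sum_product', ← Finset.sum_filter, Finset.sum_congr rfl step3,
    Finset.sum_const, nsmul_eq_mul]
  ring

/-- **T3a `reduction_local` — S-local, eventual-in-`n` product-vector (Bohr–Fejér) reduction.**
For any kernel `w : ℝ → ℂ`, a fixed finite set of primes `S` and `n₀`: if the Hermitian
multiplicative-Toeplitz form `Σ c_d conj(c_{d'}) w(log d − log d')` has nonnegative real part on every
Bohr-twisted flat divisor box `c = χ_θ · 1_{· ∣ ∏_{p∈S} p^n}` with `n ≥ n₀`, then it has nonnegative
real part on every coefficient vector supported on a finite set `T` of `S`-smooth positive integers.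
[folklore] -/
theorem reduction_local : ∀ (w : ℝ → ℂ) (S : Finset ℕ), (∀ p ∈ S, p.Prime) → ∀ n₀ : ℕ,
    (∀ n : ℕ, n₀ ≤ n → ∀ θ : ℕ → ℝ,
      0 ≤ (∑ d ∈ (∏ p ∈ S, p ^ n).divisors, ∑ d' ∈ (∏ p ∈ S, p ^ n).divisors,
        Complex.exp (I * ((∑ p ∈ S, θ p * (d.factorization p : ℝ) : ℝ) : ℂ)) *
          conj (Complex.exp (I * ((∑ p ∈ S, θ p * (d'.factorization p : ℝ) : ℝ) : ℂ))) *
          w (Real.log (d : ℝ) - Real.log (d' : ℝ))).re) →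
    ∀ T : Finset ℕ, (∀ m ∈ T, m ≠ 0 ∧ m.primeFactors ⊆ S) → ∀ c : ℕ → ℂ,
      0 ≤ (∑ m ∈ T, ∑ m' ∈ T,
        c m * conj (c m') * w (Real.log (m : ℝ) - Real.log (m' : ℝ))).re := by
  intro w S hSp n₀ hw T hT c
  -- `K = n₀ + max T`: every `m ∈ T` is `≤ K` and divides `∏_{p∈S} p^K`; levels `n + K` are `≥ n₀`
  set K : ℕ := n₀ + T.sup id with hK_def
  have hI : ∀ m ∈ T, m ≠ 0 := fun m hm => (hT m hm).1
  have hMS : ∀ m ∈ T, m.primeFactors ⊆ S := fun m hm => (hT m hm).2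
  have hmK : ∀ m ∈ T, m ≤ K := fun m hm =>
    (Finset.le_sup (f := id) hm).trans (Nat.le_add_left _ _)
  have hKn : ∀ n : ℕ, n₀ ≤ n + K := fun n => by omega
  have hNne : ∀ n : ℕ, (∏ p ∈ S, p ^ n) ≠ 0 := fun n =>
    Finset.prod_ne_zero_iff.mpr fun p hp => pow_ne_zero _ (hSp p hp).ne_zero
  have hmdvd : ∀ m ∈ T, m ∣ ∏ p ∈ S, p ^ K := fun m hm =>
    dvd_prod_pow S K (hI m hm) (hmK m hm) (hMS m hm)
  have hsplit : ∀ n : ℕ, ∏ p ∈ S, p ^ (n + K) = (∏ p ∈ S, p ^ n) * ∏ p ∈ S, p ^ K := fun n => by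
    rw [← Finset.prod_mul_distrib]
    exact Finset.prod_congr rfl fun p _ => pow_add p n K
  -- (P1) positivity of the count-weighted form at level `n + K` (grid averaging)
  have P1 : ∀ n : ℕ, 0 ≤ ∑ m ∈ T, ∑ m' ∈ T,
      (c m * conj (c m') * w (Real.log (m : ℝ) - Real.log (m' : ℝ))).re *
        ((((∏ p ∈ S, p ^ (n + K)).divisors ×ˢ (∏ p ∈ S, p ^ (n + K)).divisors).filter
          (fun x : ℕ × ℕ => m' * x.1 = m * x.2)).card : ℝ) := by
    intro n
    have hN0 := hNne (n + K)
    have hNS := primeFactors_prod_pow_subset S hSp (n + K)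
    set L : ℕ := K * ∏ p ∈ S, p ^ (n + K) + 1 with hL_def
    have hLpos : 0 < L := Nat.succ_pos _
    obtain ⟨θ, hθ⟩ : ∃ θ : (↥S → ℕ) → ℕ → ℝ, ∀ k (p : ↥S), θ k p = 2 * π * (k p : ℝ) / L :=
      ⟨fun k p => if h : p ∈ S then 2 * π * ((k ⟨p, h⟩ : ℕ) : ℝ) / L else 0,
        fun k p => by simp [p.2]⟩
    have hD : ∀ d ∈ (∏ p ∈ S, p ^ (n + K)).divisors, d ≠ 0 := fun d hd =>
      (Nat.pos_of_mem_divisors hd).ne'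
    have hPF : ∀ m ∈ T, ∀ d ∈ (∏ p ∈ S, p ^ (n + K)).divisors,
        (m * d).primeFactors ⊆ S := by
      intro m hm d hd
      rw [Nat.primeFactors_mul (hI m hm) (hD d hd)]
      exact Finset.union_subset (hMS m hm)
        ((Nat.primeFactors_mono (Nat.dvd_of_mem_divisors hd) hN0).trans hNS)
    have hlt : ∀ m ∈ T, ∀ d ∈ (∏ p ∈ S, p ^ (n + K)).divisors, m * d < L :=
      fun m hm d hd => by have := Nat.mul_le_mul (hmK m hm) (Nat.divisor_le hd); omega
    have key := avg_identity (Fintype.piFinset fun _ : ↥S => Finset.range L)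
      (fun k x => Complex.exp (I * ((∑ p ∈ S, θ k p * (x.factorization p : ℝ) : ℝ) : ℂ)))
      ((L : ℂ) ^ S.card) T hI (∏ p ∈ S, p ^ (n + K))
      (fun k x y hx hy => chi_mul S (θ k) hx hy)
      (fun m hm m' hm' d hd d' hd' => orth_pair S L θ hθ
        (mul_ne_zero (hI m' hm') (hD d hd)) (mul_ne_zero (hI m hm) (hD d' hd'))
        (hPF m' hm' d hd) (hPF m hm d' hd') (hlt m' hm' d hd) (hlt m hm d' hd'))
      w c
    have hpos := re_nonneg_of_sum_eq hLpos key fun k _ => by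
      rw [Complex.mul_conj, Complex.re_ofReal_mul]
      exact mul_nonneg (Complex.normSq_nonneg _) (hw (n + K) (hKn n) (θ k))
    simpa only [Complex.re_sum, re_mul_natCast] using hpos
  -- (P2) the Fejér weights `C_n(m,m') / #div N` tend to one
  have hr : ∀ m ∈ T, ∀ m' ∈ T, Filter.Tendsto (fun n : ℕ =>
      ((((∏ p ∈ S, p ^ (n + K)).divisors ×ˢ (∏ p ∈ S, p ^ (n + K)).divisors).filter
          (fun x : ℕ × ℕ => m' * x.1 = m * x.2)).card : ℝ) / ((n : ℝ) + K + 1) ^ S.card)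
        Filter.atTop (nhds 1) := by
    intro m hm m' hm'
    refine ratio_tendsto_one K S.card _ (fun n => ?_) fun n => ?_
    · rw [← card_divisors_prod_pow S hSp n]
      refine count_lower _ _ m m' (hNne _) (hI m hm) ?_ ?_
      · rw [hsplit n]
        exact mul_dvd_mul_left _ (hmdvd m hm)
      · rw [hsplit n]
        exact mul_dvd_mul_left _ (hmdvd m' hm')
    · rw [← card_divisors_prod_pow S hSp (n + K)]
      exact count_upper _ m m' (hI m hm)
  -- (P3) pass to the limit
  have hlim := tendsto_finsetSum T fun m hm =>
    tendsto_finsetSum T fun m' hm' => (hr m hm m' hm').const_mul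
      (c m * conj (c m') * w (Real.log (m : ℝ) - Real.log (m' : ℝ))).re
  have hge := ge_of_tendsto' hlim fun n => by
    have hDpos : (0 : ℝ) < ((n : ℝ) + K + 1) ^ S.card := by positivity
    simp_rw [← mul_div_assoc, ← Finset.sum_div]
    exact div_nonneg (P1 n) hDpos.le
  simp_rw [Complex.re_sum]
  simpa only [mul_one] using hge

end Summit.RiemannHypothesis.RiemannHypothesis.Theorems.WeilCombBohrFejer

end
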